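import Summits.KontsevichZagierPeriods.KontsevichZagierPeriods.Theorems.HurwitzMicroSectorsHurwitzSectorComplementStubAssemblyAuxKit

/-!
# `HurwitzSectorComplement` (stmt-KontsevichZagierPeriods-14341), line `chebyshev-level-deformation`,
# stub S5 `stub_assembly` — part 2/4: the kernel representations and polynomial bookkeeping

* The Chebyshev kernel representations on the open box exist (bounded rational integrands with real
  algebraic coefficients; `1/(1−t)` by `BoxIntegral.integrableOn_box_one_div_one_sub_prod`):
  `[(0,1)^w, T(v,t)]`, `[(0,1)^w, U(v,t)]` (`T(v,t) = ((1−t) − v²(1+t))/((1−t)² + v²(1+t)²)`,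
  `U(v,t) = 2v/((1−t)² + v²(1+t)²)`, `t = x₀⋯x_{w−1}`), `[(0,1)^w, 1/(1∓t)]`; `tan(πj/L)` is
  algebraic and positive for `0 < j < L/2`; the angle `2πj/L` lies in `(0, π)`.
* The symmetric splitting of a `(−1)^w`-symmetric numerator `R` (`deg R < N`):
  `R(t) = Σ_{i<N−1} (R_i/2)(t^i + (−1)^w t^{N−2−i}) + R_{N−1} t^{N−1}`, and the shape
  (degree, symmetry, top coefficient) of the rational pair numerators `X^i + (−1)^w X^{N−2−i}`, `X^{N−1}`.

References: M. Kontsevich, D. Zagier, *Periods* (2001), §1.1–1.2.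
-/

noncomputable section

open Set MeasureTheory
open scoped BigOperators
open Literature.NumberTheory.Transcendental

namespace Summit.KontsevichZagierPeriods.Theorems.HurwitzMicroSectorsHurwitzSectorComplement.Assembly

variable {w : ℕ}

/-! ## The kernel representations exist -/

/-- `tan(πj/L)` is algebraic (Mathlib: `Real.isAlgebraic_tan_rat_mul_pi`). [folklore] -/
theorem isAlgebraic_tan_pi_mul_div (j L : ℕ) : IsAlgebraic ℚ (Real.tan (Real.pi * j / L)) := by
  have h := (Real.isAlgebraic_tan_rat_mul_pi ((j : ℚ) / L)).extendScalars
    (R := ℤ) (S := ℚ) (A := ℝ) (RingHom.injective_int (algebraMap ℤ ℚ))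
  convert h using 2
  push_cast
  ring

/-- `0 < tan(πj/L)` for `0 < j`, `2j < L`. [folklore] -/
theorem tan_pi_mul_div_pos {j L : ℕ} (hj : 0 < j) (hjL : 2 * j < L) :
    0 < Real.tan (Real.pi * j / L) := by
  have hL : (0 : ℝ) < L := by exact_mod_cast (show 0 < L by omega)
  have hj' : (0 : ℝ) < j := by exact_mod_cast hj
  have h2 : (2 * j : ℝ) < L := by exact_mod_cast hjL
  refine Real.tan_pos_of_pos_of_lt_pi_div_two (by positivity) ?_
  rw [div_lt_div_iff₀ hL two_pos]
  nlinarith [Real.pi_pos]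

/-- On the open box the product of the coordinates is nonnegative. [folklore] -/
theorem prod_nonneg_of_mem {x : Fin w → ℝ} (hx : x ∈ KZ.unitCube w) : 0 ≤ ∏ i, x i :=
  Finset.prod_nonneg fun i _ => (hx i).1.le

/-- The Chebyshev `T`-kernel representation `[(0,1)^w, T(v, x₀⋯x_{w−1})]`,
`T(v,t) = ((1−t) − v²(1+t))/((1−t)² + v²(1+t)²)`, exists for real algebraic `v ≠ 0`
(bounded rational integrand with algebraic coefficients). [cite: KontsevichZagier2001, §1.1] -/
theorem exists_TRep (w : ℕ) {v : ℝ} (hv : IsAlgebraic ℚ v) (hv0 : v ≠ 0) :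
    ∃ s : KZ.IntegralRep w, s.domain = KZ.unitCube w ∧ s.integrand = fun x =>
      ((1 - ∏ i, x i) - v ^ 2 * (1 + ∏ i, x i)) /
        ((1 - ∏ i, x i) ^ 2 + v ^ 2 * (1 + ∏ i, x i) ^ 2) := by
  have hB := KZ.isSemialgebraic_unitCube w
  have h1 := isSemialgebraicFunOn_const_of_isAlgebraic hB isAlgebraic_one
  have hv2 := isSemialgebraicFunOn_const_of_isAlgebraic hB (hv.pow 2)
  have hp := isSemialgebraicFunOn_prod w
  refine exists_boxRep
    (((h1.fun_sub hp).fun_sub (hv2.fun_mul (h1.fun_add hp))).div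
      (((h1.fun_sub hp).fun_pow 2).fun_add (hv2.fun_mul ((h1.fun_add hp).fun_pow 2)))
      fun x hx => ?_)
    (integrableOn_box_comp_prod
      (g := fun t => ((1 - t) - v ^ 2 * (1 + t)) / ((1 - t) ^ 2 + v ^ 2 * (1 + t) ^ 2)) ?_)
  · have ht := prod_nonneg_of_mem hx
    positivity
  · refine ContinuousOn.div (by fun_prop) (by fun_prop) fun t ht => ?_
    have := ht.1
    positivity

/-- The Chebyshev `U`-kernel representation `[(0,1)^w, U(v, x₀⋯x_{w−1})]`,
`U(v,t) = 2v/((1−t)² + v²(1+t)²)`, exists for real algebraic `v ≠ 0`. [cite: KontsevichZagier2001, §1.1] -/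
theorem exists_URep (w : ℕ) {v : ℝ} (hv : IsAlgebraic ℚ v) (hv0 : v ≠ 0) :
    ∃ s : KZ.IntegralRep w, s.domain = KZ.unitCube w ∧ s.integrand = fun x =>
      2 * v / ((1 - ∏ i, x i) ^ 2 + v ^ 2 * (1 + ∏ i, x i) ^ 2) := by
  have hB := KZ.isSemialgebraic_unitCube w
  have h1 := isSemialgebraicFunOn_const_of_isAlgebraic hB isAlgebraic_one
  have hv2 := isSemialgebraicFunOn_const_of_isAlgebraic hB (hv.pow 2)
  have h2v : IsSemialgebraicFunOn ℚ (KZ.unitCube w) (fun _ => 2 * v) :=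
    isSemialgebraicFunOn_const_of_isAlgebraic hB
      ((show IsAlgebraic ℚ (2 : ℝ) by simpa using isAlgebraic_nat (R := ℚ) (A := ℝ) 2).mul hv)
  have hp := isSemialgebraicFunOn_prod w
  refine exists_boxRep
    (h2v.div (((h1.fun_sub hp).fun_pow 2).fun_add (hv2.fun_mul ((h1.fun_add hp).fun_pow 2)))
      fun x hx => ?_)
    (integrableOn_box_comp_prod
      (g := fun t => 2 * v / ((1 - t) ^ 2 + v ^ 2 * (1 + t) ^ 2)) ?_)
  · have ht := prod_nonneg_of_mem hx
    positivity
  · refine ContinuousOn.div (by fun_prop) (by fun_prop) fun t ht => ?_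
    have := ht.1
    positivity

/-- The level-1 representation `[(0,1)^w, 1/(1 − x₀⋯x_{w−1})]` exists for `w ≥ 2`
(`BoxIntegral.integrableOn_box_one_div_one_sub_prod`). [cite: KontsevichZagier2001, §1.1] -/
theorem exists_invOneSubRep (hw : 2 ≤ w) :
    ∃ s : KZ.IntegralRep w, s.domain = KZ.unitCube w ∧ s.integrand = fun x =>
      1 / (1 - ∏ i, x i) := by
  have hB := KZ.isSemialgebraic_unitCube w
  refine exists_boxRep
    ((isSemialgebraicFunOn_const_of_isAlgebraic hB isAlgebraic_one).div
      ((isSemialgebraicFunOn_const_of_isAlgebraic hB isAlgebraic_one).fun_sub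
        (isSemialgebraicFunOn_prod w)) fun x hx => ?_)
    (BoxIntegral.integrableOn_box_one_div_one_sub_prod hw)
  exact (sub_pos.mpr (BoxIntegral.prod_mem_Ioo (by omega) hx).2).ne'

/-- The level-2 representation `[(0,1)^w, 1/(1 + x₀⋯x_{w−1})]` exists. [cite: KontsevichZagier2001, §1.1] -/
theorem exists_invOneAddRep (w : ℕ) :
    ∃ s : KZ.IntegralRep w, s.domain = KZ.unitCube w ∧ s.integrand = fun x =>
      1 / (1 + ∏ i, x i) := by
  have hB := KZ.isSemialgebraic_unitCube w
  refine exists_boxRep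
    ((isSemialgebraicFunOn_const_of_isAlgebraic hB isAlgebraic_one).div
      ((isSemialgebraicFunOn_const_of_isAlgebraic hB isAlgebraic_one).fun_add
        (isSemialgebraicFunOn_prod w)) fun x hx => ?_)
    (integrableOn_box_comp_prod (g := fun t => 1 / (1 + t)) ?_)
  · have ht := prod_nonneg_of_mem hx
    positivity
  · refine ContinuousOn.div (by fun_prop) (by fun_prop) fun t ht => ?_
    have := ht.1
    positivity

/-- `2πj/L ∈ (0, π)` for `0 < j`, `2j < L`, and its half is `πj/L`. [folklore] -/
theorem angle_mem {j L : ℕ} (hj : 0 < j) (hjL : 2 * j < L) :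
    0 < 2 * Real.pi * j / L ∧ 2 * Real.pi * j / L < Real.pi ∧
      2 * Real.pi * j / L / 2 = Real.pi * j / L := by
  have hL : (0 : ℝ) < L := by exact_mod_cast (show 0 < L by omega)
  have hj' : (0 : ℝ) < j := by exact_mod_cast hj
  have h2 : (2 * j : ℝ) < L := by exact_mod_cast hjL
  refine ⟨by positivity, ?_, by ring⟩
  rw [div_lt_iff₀ hL]
  nlinarith [Real.pi_pos]

/-! ## Polynomial bookkeeping for the symmetric splitting -/

open Polynomial in
/-- **Symmetric splitting of the polar numerator.** If `deg R < N` and `R_i = (−1)^w R_j`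
whenever `i + j + 2 = N`, then
`R(t) = Σ_{i < N−1} (R_i/2)(t^i + (−1)^w t^{N−2−i}) + R_{N−1} t^{N−1}`. [folklore] -/
theorem eval_symm_split {K : Type*} [Field K] [CharZero K] (R : K[X]) {N w : ℕ} (hN : 1 ≤ N)
    (hR : R.natDegree < N) (hsym : ∀ i j : ℕ, i + j + 2 = N → R.coeff i = (-1 : K) ^ w * R.coeff j)
    (t : K) :
    R.eval t = ∑ i ∈ Finset.range (N - 1), R.coeff i / 2 * (t ^ i + (-1 : K) ^ w * t ^ (N - 2 - i)) +
      R.coeff (N - 1) * t ^ (N - 1) := by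
  obtain ⟨M, rfl⟩ : ∃ M, N = M + 1 := ⟨N - 1, by omega⟩
  rw [Polynomial.eval_eq_sum_range' hR, Finset.sum_range_succ, Nat.add_sub_cancel]
  congr 1
  have hrefl : ∑ i ∈ Finset.range M, R.coeff i * t ^ i =
      ∑ i ∈ Finset.range M, (-1 : K) ^ w * R.coeff i * t ^ (M - 1 - i) := by
    rw [← Finset.sum_range_reflect (fun i => R.coeff i * t ^ i) M]
    refine Finset.sum_congr rfl fun i hi => ?_
    rw [hsym (M - 1 - i) i (by have := Finset.mem_range.mp hi; omega)]
  have hhalf : ∀ i ∈ Finset.range M, R.coeff i / 2 * (t ^ i + (-1 : K) ^ w * t ^ (M + 1 - 2 - i)) =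
      (R.coeff i * t ^ i + (-1 : K) ^ w * R.coeff i * t ^ (M - 1 - i)) / 2 := by
    intro i _
    rw [show M + 1 - 2 - i = M - 1 - i by omega]
    ring
  rw [Finset.sum_congr rfl hhalf, ← Finset.sum_div, Finset.sum_add_distrib, ← hrefl]
  ring

open Polynomial in
/-- The elementary symmetric pair numerator `X^i + (−1)^w X^{N−2−i}` (`i < N − 1`) has degree
`< N`, is `(−1)^w`-symmetric, and has no `X^{N−1}` term. [folklore] -/
theorem symmPair_shape {N w i : ℕ} (hi : i < N - 1) :
    (X ^ i + C ((-1 : ℚ) ^ w) * X ^ (N - 2 - i) : ℚ[X]).natDegree < N ∧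
    (∀ i' j' : ℕ, i' + j' + 2 = N →
      (X ^ i + C ((-1 : ℚ) ^ w) * X ^ (N - 2 - i) : ℚ[X]).coeff i' =
        (-1 : ℚ) ^ w * (X ^ i + C ((-1 : ℚ) ^ w) * X ^ (N - 2 - i) : ℚ[X]).coeff j') ∧
    (X ^ i + C ((-1 : ℚ) ^ w) * X ^ (N - 2 - i) : ℚ[X]).coeff (N - 1) = 0 := by
  have hsq : (-1 : ℚ) ^ w * (-1) ^ w = 1 := by
    rw [← mul_pow, neg_one_mul, neg_neg, one_pow]
  refine ⟨?_, fun i' j' h => ?_, ?_⟩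
  · refine (natDegree_add_le _ _).trans_lt (max_lt ?_ ((natDegree_C_mul_X_pow_le _ _).trans_lt ?_))
    · rw [natDegree_X_pow]; omega
    · omega
  · simp only [coeff_add, coeff_X_pow, coeff_C_mul_X_pow]
    by_cases h1 : i' = i
    · by_cases h2 : i' = N - 2 - i
      · rw [if_pos h1, if_pos h2, if_pos (by omega), if_pos (by omega)]
        linear_combination (-1 : ℚ) * hsq
      · rw [if_pos h1, if_neg h2, if_neg (by omega), if_pos (by omega)]
        linear_combination (-1 : ℚ) * hsq
    · by_cases h2 : i' = N - 2 - i
      · rw [if_neg h1, if_pos h2, if_pos (by omega), if_neg (by omega)]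
        ring
      · rw [if_neg h1, if_neg h2, if_neg (by omega), if_neg (by omega)]
        ring
  · simp only [coeff_add, coeff_X_pow, coeff_C_mul_X_pow]
    rw [if_neg (by omega), if_neg (by omega), add_zero]

open Polynomial in
/-- `X^{N−1}` has degree `< N` and is (vacuously) `(−1)^w`-symmetric. [folklore] -/
theorem topMonomial_shape {N w : ℕ} (hN : 1 ≤ N) :
    (X ^ (N - 1) : ℚ[X]).natDegree < N ∧
    (∀ i' j' : ℕ, i' + j' + 2 = N →
      (X ^ (N - 1) : ℚ[X]).coeff i' = (-1 : ℚ) ^ w * (X ^ (N - 1) : ℚ[X]).coeff j') := by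
  refine ⟨by rw [natDegree_X_pow]; omega, fun i' j' h => ?_⟩
  rw [coeff_X_pow, coeff_X_pow, if_neg (by omega), if_neg (by omega), mul_zero]

end Summit.KontsevichZagierPeriods.Theorems.HurwitzMicroSectorsHurwitzSectorComplement.Assembly

namespace Summit.KontsevichZagierPeriods.Theorems.HurwitzMicroSectorsHurwitzSectorComplement

/-- **Registered sub-goal `assemblyReps_TRep` of `stub_assembly`**: the Chebyshev `T`-kernel
representation on the open box exists for real algebraic `v ≠ 0` (`Assembly.exists_TRep`).
[cite: KontsevichZagier2001, §1.1] -/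
theorem assemblyReps_TRep : ∀ (w : ℕ) (v : ℝ), IsAlgebraic ℚ v → v ≠ 0 → ∃ s : KZ.IntegralRep w, s.domain = {x | ∀ i, x i ∈ Set.Ioo (0:ℝ) 1} ∧ s.integrand = fun x => ((1 - ∏ i, x i) - v ^ 2 * (1 + ∏ i, x i)) / ((1 - ∏ i, x i) ^ 2 + v ^ 2 * (1 + ∏ i, x i) ^ 2) :=
  fun w _ hv hv0 => Assembly.exists_TRep w hv hv0

end Summit.KontsevichZagierPeriods.Theorems.HurwitzMicroSectorsHurwitzSectorComplement


end
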